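import Summits.CriticalPhenomena.SAWScalingLimit.Theorems.SAWLoopFugacityFlowIsingBoundaryRatioWindowRectHoles
import HarnessLib

/-!
# Filling the holes of an induced edge set of the mesh graph
(line `fk-anchor-transfer`, crux `IsingBoundaryRatio`, stmt-CriticalPhenomena-10650; helper file of the stub
`windowRectPresentation_holds`)

**Theorem** (`exists_filled_edgeSet`). Let `E₀` be a nonempty finite set of edges of the mesh graph `Ω_δ` of
a Jordan domain which is INDUCED (every edge of `Ω_δ` between two of its vertices belongs to it) and
CONNECTED. Let `E ⊇ E₀` be the set of edges of `Ω_δ` between the vertices of `E₀` and the corners of the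
hole faces of `E₀` (`…WindowRectHoles`). Then `E` is a finite induced connected set of edges of `Ω_δ`,
every face with a side off `E` escapes to arbitrary height across sides off `E` (the combinatorial
hole-freeness consumed by `…WindowRectCover`), every boundary vertex of `E` (a vertex with a missing lattice
edge) is a vertex of `E₀`, and every vertex of `E` is a vertex of `E₀` or a corner of a hole face of `E₀`.
[folklore]
-/

noncomputable section

open Set Metric Complex SimpleGraph Literature.Probability.RandomPlanarGeometry Literature.Probability.LatticeModels
  Literature.Probability.LatticeModels.Mesh Literature.Probability.LatticeModels.DiscreteRect

namespace Summit.CriticalPhenomena.SAWScalingLimit.Theorems.IsingBoundaryRatio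

namespace WindowRect

/-- A translate of a face by a corner offset is a corner. [folklore] -/
theorem isCorner_add_cornerOff (f : Site 2) (j : Fin 4) : IsCorner (f + cornerOff j) f := by
  have := isCorner_faceAt (f + cornerOff j) j
  rwa [faceAt_add_cornerOff] at this

/-- `x + e_k` is a corner of the face `faceAt x k`. [folklore] -/
theorem isCorner_add_cornerUnit_faceAt (x : Site 2) (k : Fin 4) : IsCorner (x + cornerUnit k) (faceAt x k) := by
  have : x + cornerUnit k = faceAt x k + cornerOff (k + 1) := by
    rw [faceAt, cornerUnit_eq_off_sub]; abel
  rw [this]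
  exact isCorner_add_cornerOff _ _

/-- The corners of a face form a finite set. [folklore] -/
theorem finite_setOf_isCorner (f : Site 2) : {v : Site 2 | IsCorner v f}.Finite := by
  refine (Set.finite_range (fun p : Bool × Bool => Mesh.corner (f 0) (f 1) p.1 p.2)).subset fun v hv => ?_
  obtain ⟨a, b, rfl⟩ := exists_corner_eq_of_isCorner hv
  exact ⟨(a, b), rfl⟩

/-- An edge of a simple graph on `Site 2` is `s(x, y)` for an adjacent pair. [folklore] -/
theorem exists_eq_of_mem_edgeSet {G : SimpleGraph (Site 2)} {e : Sym2 (Site 2)} (he : e ∈ G.edgeSet) :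
    ∃ x y, G.Adj x y ∧ e = s(x, y) := by
  induction e using Sym2.ind with
  | h x y => exact ⟨x, y, he, rfl⟩

section Exit

variable {E₀ : Finset (Sym2 (Site 2))} {S : Site 2 → Site 2 → Prop}
  (hS : ∀ a b, S a b ↔ ∃ k : Fin 4, b = a + cornerUnit k ∧ s(a + cornerOff (k + 1), a + cornerOff (k + 2)) ∉ E₀)

include hS in
/-- **Walking east out of the hole, along sides of hole faces.** Every corner of a hole face is joined to a
vertex of `E₀` by a chain of lattice edges each of which is a side of a hole face. [folklore] -/
theorem exists_chain_exit_of_hole {h : Site 2}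
    (hh : ¬ ∀ M : ℤ, ∃ g' : Site 2, M ≤ g' 1 ∧ Relation.ReflTransGen S h g') {v : Site 2} (hv : IsCorner v h) :
    ∃ u ∈ verts E₀, Relation.ReflTransGen
      (fun p q : Site 2 => ∃ h' : Site 2, (¬ ∀ M : ℤ, ∃ g' : Site 2, M ≤ g' 1 ∧ Relation.ReflTransGen S h' g') ∧
        IsCorner p h' ∧ IsCorner q h' ∧ (zdGraph 2).Adj p q) v u := by
  classical
  -- some face east of `h` escapes
  have hex : ∃ n : ℕ, ∀ M : ℤ, ∃ g' : Site 2, M ≤ g' 1 ∧ Relation.ReflTransGen S (h + n • cornerUnit 0) g' := by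
    by_contra hall
    have hall' : ∀ n : ℕ, ¬ ∀ M : ℤ, ∃ g' : Site 2, M ≤ g' 1 ∧ Relation.ReflTransGen S (h + n • cornerUnit 0) g' :=
      fun n hn => hall ⟨n, hn⟩
    obtain ⟨m, n, hmn, heq⟩ := (finite_hole hS).exists_lt_map_eq_of_forall_mem (f := fun n : ℕ => h + n • cornerUnit 0)
      fun n => by simpa only [Set.mem_setOf_eq] using hall' n
    have := congrFun heq 0
    simp only [add_nsmul_cornerUnit_apply] at this
    simp at this
    omega
  have hN := Nat.find_spec hex
  obtain ⟨m, hm⟩ : ∃ m, Nat.find hex = m + 1 := by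
    refine ⟨Nat.find hex - 1, ?_⟩
    have h0 : Nat.find hex ≠ 0 := fun h0 => by rw [h0] at hN; simp at hN; exact hh hN
    omega
  have hmem : ∀ i ≤ m, ¬ ∀ M : ℤ, ∃ g' : Site 2, M ≤ g' 1 ∧ Relation.ReflTransGen S (h + i • cornerUnit 0) g' :=
    fun i hi => Nat.find_min hex (m := i) (by omega)
  set a := h + m • cornerUnit 0 with ha
  have haH := hmem m le_rfl
  have hbH : ∀ M : ℤ, ∃ g' : Site 2, M ≤ g' 1 ∧ Relation.ReflTransGen S (a + cornerUnit 0) g' := by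
    rw [ha, ← add_succ_nsmul_cornerUnit, ← hm]; exact hN
  -- the exit vertex `u = a + e₀`, a vertex of `E₀`
  have huE : a + cornerUnit 0 ∈ verts E₀ := by
    have hside := mem_of_hole_of_not_hole hS haH hbH
    simp only [zero_add] at hside
    rw [← cornerOff_one_eq_cornerUnit_zero]
    refine fst_mem_verts_of_aedge_mem (a := (a + cornerOff 1, 1)) ?_
    simp only [aedge, dir_eq_cornerUnit, cornerUnit_eq_off_sub]
    rw [show a + cornerOff 1 + (cornerOff (1 + 1) - cornerOff 1) = a + cornerOff 2 by
      rw [show (1 + 1 : Fin 4) = 2 from rfl]; abel]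
    exact hside
  refine ⟨a + cornerUnit 0, huE, ?_⟩
  -- the chain: within `h` from `v` to `h`, then east along bottom sides, then to `a + e₀`
  have hcor : ∀ (f : Site 2) (c d : Bool), IsCorner (Mesh.corner (f 0) (f 1) c d) f := fun f c d =>
    isCorner_of_coords (by cases c <;> simp) (by cases d <;> simp)
  have hf0 : ∀ f : Site 2, f = Mesh.corner (f 0) (f 1) false false := fun f =>
    funext fun i => by fin_cases i <;> simp
  -- `v → lower-left corner of h`
  have step0 : Relation.ReflTransGen
      (fun p q : Site 2 => ∃ h' : Site 2, (¬ ∀ M : ℤ, ∃ g' : Site 2, M ≤ g' 1 ∧ Relation.ReflTransGen S h' g') ∧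
        IsCorner p h' ∧ IsCorner q h' ∧ (zdGraph 2).Adj p q) v h := by
    obtain ⟨c, d, rfl⟩ := exists_corner_eq_of_isCorner hv
    have s1 : Relation.ReflTransGen
        (fun p q : Site 2 => ∃ h' : Site 2, (¬ ∀ M : ℤ, ∃ g' : Site 2, M ≤ g' 1 ∧ Relation.ReflTransGen S h' g') ∧
          IsCorner p h' ∧ IsCorner q h' ∧ (zdGraph 2).Adj p q)
        (Mesh.corner (h 0) (h 1) c d) (Mesh.corner (h 0) (h 1) c false) := by
      cases d
      · exact Relation.ReflTransGen.refl
      · exact Relation.ReflTransGen.single ⟨h, hh, hcor h c true, hcor h c false,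
          (zdGraph_adj_corner_vertical _ _ c).symm⟩
    refine s1.trans ?_
    cases c
    · rw [← hf0 h]
    · refine Relation.ReflTransGen.single ⟨h, hh, hcor h true false, isCorner_self h, ?_⟩
      have := (zdGraph_adj_corner_horizontal (h 0) (h 1) false).symm
      rwa [← hf0 h] at this
  -- east along the bottom sides
  have chain : ∀ i ≤ m, Relation.ReflTransGen
      (fun p q : Site 2 => ∃ h' : Site 2, (¬ ∀ M : ℤ, ∃ g' : Site 2, M ≤ g' 1 ∧ Relation.ReflTransGen S h' g') ∧
        IsCorner p h' ∧ IsCorner q h' ∧ (zdGraph 2).Adj p q) h (h + i • cornerUnit 0) := by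
    intro i
    induction i with
    | zero => intro; rw [zero_nsmul, add_zero]
    | succ i ih =>
      intro hi
      refine (ih (by omega)).tail ⟨h + i • cornerUnit 0, hmem i (by omega), isCorner_self _, ?_, ?_⟩
      · have := isCorner_faceAt (h + i • cornerUnit 0 + cornerOff 1) 1
        rwa [faceAt_add_cornerOff, cornerOff_one_eq_cornerUnit_zero, ← add_succ_nsmul_cornerUnit] at this
      · rw [add_succ_nsmul_cornerUnit]; exact zdGraph_adj_add_cornerUnit _ _
  have last : Relation.ReflTransGen
      (fun p q : Site 2 => ∃ h' : Site 2, (¬ ∀ M : ℤ, ∃ g' : Site 2, M ≤ g' 1 ∧ Relation.ReflTransGen S h' g') ∧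
        IsCorner p h' ∧ IsCorner q h' ∧ (zdGraph 2).Adj p q) a (a + cornerUnit 0) := by
    refine Relation.ReflTransGen.single ⟨a, haH, isCorner_self _, ?_, zdGraph_adj_add_cornerUnit _ _⟩
    have := isCorner_faceAt (a + cornerOff 1) 1
    rwa [faceAt_add_cornerOff, cornerOff_one_eq_cornerUnit_zero] at this
  exact (step0.trans (chain m le_rfl)).trans last

end Exit

variable (D : JordanDomain) {δ : ℝ} (hδ : 0 < δ) {E₀ : Finset (Sym2 (Site 2))}
  (hE₀ : ∀ e ∈ E₀, e ∈ (discreteDomainGraph D.carrier δ).edgeSet)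
  (hind : ∀ x ∈ verts E₀, ∀ y ∈ verts E₀, (discreteDomainGraph D.carrier δ).Adj x y → s(x, y) ∈ E₀)
  (hconn : ∀ x ∈ verts E₀, ∀ y ∈ verts E₀, Relation.ReflTransGen (fun a b : Site 2 => s(a, b) ∈ E₀) x y)

include hδ hE₀ hind hconn

/-- **Filling the holes of an induced connected edge set of `Ω_δ`.** See the module docstring. [folklore] -/
theorem exists_filled_edgeSet :
    ∃ E : Finset (Sym2 (Site 2)), E₀ ⊆ E ∧
      (∀ e ∈ E, e ∈ (discreteDomainGraph D.carrier δ).edgeSet) ∧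
      (∀ x ∈ verts E, ∀ y ∈ verts E, (discreteDomainGraph D.carrier δ).Adj x y → s(x, y) ∈ E) ∧
      (∀ x ∈ verts E, ∀ y ∈ verts E, Relation.ReflTransGen (fun a b : Site 2 => s(a, b) ∈ E) x y) ∧
      (∀ g : Site 2, (∃ j : Fin 4, s(corner g j, corner g j + dir j) ∉ E) → ∀ M : ℤ, ∃ g' : Site 2,
        M ≤ g' 1 ∧ Relation.ReflTransGen
          (fun a b : Site 2 => ∃ j : Fin 4, b = a + dir (j + 3) ∧ s(corner a j, corner a j + dir j) ∉ E) g g') ∧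
      (∀ x ∈ bdVerts E, x ∈ verts E₀) ∧
      (∀ x ∈ verts E, x ∈ verts E₀ ∨ ∃ h : Site 2, IsCorner x h ∧
        ¬ ∀ M : ℤ, ∃ g' : Site 2, M ≤ g' 1 ∧ Relation.ReflTransGen
          (fun a b : Site 2 => ∃ k : Fin 4, b = a + cornerUnit k ∧
            s(a + cornerOff (k + 1), a + cornerOff (k + 2)) ∉ E₀) h g') := by
  classical
  -- the step relation and the hole
  set S : Site 2 → Site 2 → Prop := fun a b => ∃ k : Fin 4, b = a + cornerUnit k ∧
    s(a + cornerOff (k + 1), a + cornerOff (k + 2)) ∉ E₀ with hSdef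
  have hS : ∀ a b, S a b ↔ ∃ k : Fin 4, b = a + cornerUnit k ∧
      s(a + cornerOff (k + 1), a + cornerOff (k + 2)) ∉ E₀ := fun a b => Iff.rfl
  set Hset : Set (Site 2) := {a | ¬ ∀ M : ℤ, ∃ g' : Site 2, M ≤ g' 1 ∧ Relation.ReflTransGen S a g'} with hHset
  have hHfin : Hset.Finite := finite_hole hS
  -- the vertex set and the edge set
  set Vset : Set (Site 2) := (↑(verts E₀) : Set (Site 2)) ∪ ⋃ h ∈ Hset, {v | IsCorner v h} with hVset
  have hVfin : Vset.Finite := (verts E₀).finite_toSet.union (hHfin.biUnion fun h _ => finite_setOf_isCorner h)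
  set Vfin : Finset (Site 2) := hVfin.toFinset with hVfin'
  have hmemV : ∀ x, x ∈ Vfin ↔ x ∈ Vset := fun x => Set.Finite.mem_toFinset _
  set E : Finset (Sym2 (Site 2)) := ((Vfin ×ˢ Vfin).filter fun p =>
    (discreteDomainGraph D.carrier δ).Adj p.1 p.2).image fun p => s(p.1, p.2) with hEdef
  have hmemE : ∀ e, e ∈ E ↔ ∃ x y, x ∈ Vset ∧ y ∈ Vset ∧ (discreteDomainGraph D.carrier δ).Adj x y ∧ e = s(x, y) := by
    intro e
    simp only [hEdef, Finset.mem_image, Finset.mem_filter, Finset.mem_product, hmemV, Prod.exists]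
    constructor
    · rintro ⟨x, y, ⟨⟨hx, hy⟩, hxy⟩, rfl⟩; exact ⟨x, y, hx, hy, hxy, rfl⟩
    · rintro ⟨x, y, hx, hy, hxy, rfl⟩; exact ⟨x, y, ⟨⟨hx, hy⟩, hxy⟩, rfl⟩
  have hmemE' : ∀ {x y}, x ∈ Vset → y ∈ Vset → (discreteDomainGraph D.carrier δ).Adj x y → s(x, y) ∈ E :=
    fun {x y} hx hy hxy => (hmemE _).2 ⟨x, y, hx, hy, hxy, rfl⟩
  have hVE₀ : ∀ {x}, x ∈ verts E₀ → x ∈ Vset := fun {x} hx => Or.inl hx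
  have hVH : ∀ {x h}, h ∈ Hset → IsCorner x h → x ∈ Vset := fun {x h} hh hx =>
    Or.inr (Set.mem_iUnion₂.2 ⟨h, hh, hx⟩)
  -- (a) `E₀ ⊆ E`
  have hsub : E₀ ⊆ E := by
    intro e he
    obtain ⟨x, y, hxy, rfl⟩ := exists_eq_of_mem_edgeSet (hE₀ e he)
    exact hmemE' (hVE₀ (mem_verts_of_mem (by rw [Sym2.eq_swap]; exact he))) (hVE₀ (mem_verts_of_mem he)) hxy
  -- (b) edges of `Ω_δ`
  have hedge : ∀ e ∈ E, e ∈ (discreteDomainGraph D.carrier δ).edgeSet := by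
    intro e he
    obtain ⟨x, y, -, -, hxy, rfl⟩ := (hmemE e).1 he
    exact hxy
  -- vertices of `E` are in `Vset`
  have hvertsV : ∀ {x}, x ∈ verts E → x ∈ Vset := by
    intro x hx
    obtain ⟨e, he, hxe⟩ := Finset.mem_biUnion.1 hx
    obtain ⟨p, q, hp, hq, -, rfl⟩ := (hmemE e).1 he
    simp only [endpts, Sym2.lift_mk, Finset.mem_insert, Finset.mem_singleton] at hxe
    rcases hxe with rfl | rfl
    · exact hp
    · exact hq
  -- (e) sides of hole faces are in `E`
  have hholeside : ∀ {h v w}, h ∈ Hset → IsCorner v h → IsCorner w h → (zdGraph 2).Adj v w → s(v, w) ∈ E :=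
    fun {h v w} hh hv hw hvw => hmemE' (hVH hh hv) (hVH hh hw) (adj_of_hole_side D hδ hE₀ hS hh hv hw hvw)
  -- (f) `verts E₀ ⊆ verts E`
  have hverts₀ : ∀ {x}, x ∈ verts E₀ → x ∈ verts E := by
    intro x hx
    obtain ⟨e, he, hxe⟩ := Finset.mem_biUnion.1 hx
    exact Finset.mem_biUnion.2 ⟨e, hsub he, hxe⟩
  refine ⟨E, hsub, hedge, fun x hx y hy hxy => hmemE' (hvertsV hx) (hvertsV hy) hxy, ?_, ?_, ?_, ?_⟩
  · -- (g) connected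
    -- every vertex of `Vset` is joined to a vertex of `E₀`
    have toE₀ : ∀ {x}, x ∈ Vset → ∃ u ∈ verts E₀, Relation.ReflTransGen (fun a b : Site 2 => s(a, b) ∈ E) x u := by
      intro x hx
      rcases hx with hx | hx
      · exact ⟨x, hx, Relation.ReflTransGen.refl⟩
      · obtain ⟨h, hh, hxh⟩ := Set.mem_iUnion₂.1 hx
        obtain ⟨u, hu, hchain⟩ := exists_chain_exit_of_hole hS hh hxh
        have conv : ∀ b : Site 2, Relation.ReflTransGen
            (fun p q : Site 2 => ∃ h' : Site 2, (¬ ∀ M : ℤ, ∃ g' : Site 2, M ≤ g' 1 ∧ Relation.ReflTransGen S h' g') ∧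
              IsCorner p h' ∧ IsCorner q h' ∧ (zdGraph 2).Adj p q) x b →
            Relation.ReflTransGen (fun a b : Site 2 => s(a, b) ∈ E) x b := by
          intro b hb
          induction hb with
          | refl => exact Relation.ReflTransGen.refl
          | tail _ hpq ih =>
            obtain ⟨h', hh', hp, hq, hpq⟩ := hpq
            exact ih.tail (hholeside hh' hp hq hpq)
        exact ⟨u, hu, conv u hchain⟩
    have hsymm : ∀ {x y}, Relation.ReflTransGen (fun a b : Site 2 => s(a, b) ∈ E) x y →
        Relation.ReflTransGen (fun a b : Site 2 => s(a, b) ∈ E) y x := by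
      intro x y h
      induction h with
      | refl => exact Relation.ReflTransGen.refl
      | tail _ hbc ih => exact Relation.ReflTransGen.head (by rw [Sym2.eq_swap]; exact hbc) ih
    intro x hx y hy
    obtain ⟨u, hu, hxu⟩ := toE₀ (hvertsV hx)
    obtain ⟨w, hw, hyw⟩ := toE₀ (hvertsV hy)
    have conv : ∀ b : Site 2, Relation.ReflTransGen (fun a b : Site 2 => s(a, b) ∈ E₀) u b →
        Relation.ReflTransGen (fun a b : Site 2 => s(a, b) ∈ E) u b := by
      intro b hb
      induction hb with
      | refl => exact Relation.ReflTransGen.refl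
      | tail _ hpq ih => exact ih.tail (hsub hpq)
    exact (hxu.trans (conv w (hconn u hu w hw))).trans (hsymm hyw)
  · -- (i) faces with a side off `E` escape across sides off `E`
    intro g hg M
    obtain ⟨j, hj⟩ := hg
    -- `g` is not a hole face
    have hgH : ∀ M : ℤ, ∃ g' : Site 2, M ≤ g' 1 ∧ Relation.ReflTransGen S g g' := by
      by_contra hgH
      apply hj
      rw [corner_eq_add_cornerOff, dir_eq_cornerUnit, cornerUnit_eq_off_sub,
        show g + cornerOff j + (cornerOff (j + 1) - cornerOff j) = g + cornerOff (j + 1) by abel]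
      refine hholeside hgH (isCorner_add_cornerOff g j) (isCorner_add_cornerOff g (j + 1)) ?_
      rw [show g + cornerOff (j + 1) = g + cornerOff j + cornerUnit j by rw [cornerUnit_eq_off_sub]; abel]
      exact zdGraph_adj_add_cornerUnit _ _
    obtain ⟨g', hM, hchain⟩ := hgH M
    refine ⟨g', hM, ?_⟩
    -- one step of an escaping face is a step across a side off `E`
    have key : ∀ {c c' : Site 2}, (∀ M : ℤ, ∃ g' : Site 2, M ≤ g' 1 ∧ Relation.ReflTransGen S c g') → S c c' →
        ∃ j : Fin 4, c' = c + dir (j + 3) ∧ s(corner c j, corner c j + dir j) ∉ E := by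
      intro c c' hc hcc'
      obtain ⟨k, rfl, hk⟩ := hcc'
      refine ⟨k + 1, by rw [fin4_add_one_add_three, dir_eq_cornerUnit], ?_⟩
      rw [side_eq]
      intro hmem
      -- both ends of the side are vertices of `E₀`: else `c` would be a hole face
      have hends : ∀ w, w ∈ Vset → IsCorner w c → w ∈ verts E₀ := by
        intro w hw hwc
        by_contra hwE
        rcases hw with hw | hw
        · exact hwE hw
        · obtain ⟨h, hh, hwh⟩ := Set.mem_iUnion₂.1 hw
          obtain ⟨i, hi⟩ := exists_faceAt_of_isCorner hwc
          have := hole_faceAt_of_not_mem_verts hS hh hwh hwE i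
          rw [← hi] at this
          exact this hc
      have h1 := hends _ (hvertsV (mem_verts_of_mem (by rw [Sym2.eq_swap]; exact hmem))) (isCorner_add_cornerOff c (k + 1))
      have h2 := hends _ (hvertsV (mem_verts_of_mem hmem)) (isCorner_add_cornerOff c (k + 2))
      have hadj : (discreteDomainGraph D.carrier δ).Adj (c + cornerOff (k + 1)) (c + cornerOff (k + 2)) := by
        have := hedge _ hmem
        rwa [SimpleGraph.mem_edgeSet] at this
      exact hk (hind _ h1 _ h2 hadj)
    clear hM
    induction hchain with
    | refl => exact Relation.ReflTransGen.refl
    | tail hab hbc ih => exact ih.tail (key (esc_of_reflTransGen hS hab hgH) hbc)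
  · -- (h) boundary vertices are vertices of `E₀`
    intro x hx
    obtain ⟨k, hxv, hxk⟩ := hx
    by_contra hxE
    rcases hvertsV hxv with h | h
    · exact hxE h
    · obtain ⟨h, hh, hxh⟩ := Set.mem_iUnion₂.1 h
      have hface := hole_faceAt_of_not_mem_verts hS hh hxh hxE k
      apply hxk
      simp only [dir_eq_cornerUnit]
      exact hholeside hface (isCorner_faceAt x k) (isCorner_add_cornerUnit_faceAt x k) (zdGraph_adj_add_cornerUnit _ _)
  · -- (j) the new vertices are corners of hole faces
    intro x hx
    rcases hvertsV hx with h | h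
    · exact Or.inl h
    · obtain ⟨h, hh, hxh⟩ := Set.mem_iUnion₂.1 h
      exact Or.inr ⟨h, hxh, hh⟩

end WindowRect

/-- **Filling the holes of an induced connected edge set of `Ω_δ`**, closed form (registered sub-goal of
stmt-CriticalPhenomena-10650). [folklore] -/
theorem windowRect_exists_filled_edgeSet : ∀ (D : Literature.Probability.RandomPlanarGeometry.JordanDomain) {δ : ℝ}, 0 < δ → ∀ {E₀ : Finset (Sym2 (Site 2))}, (∀ e ∈ E₀, e ∈ (discreteDomainGraph D.carrier δ).edgeSet) → (∀ x ∈ DiscreteRect.verts E₀, ∀ y ∈ DiscreteRect.verts E₀, (discreteDomainGraph D.carrier δ).Adj x y → s(x, y) ∈ E₀) → (∀ x ∈ DiscreteRect.verts E₀, ∀ y ∈ DiscreteRect.verts E₀, Relation.ReflTransGen (fun a b : Site 2 => s(a, b) ∈ E₀) x y) → ∃ E : Finset (Sym2 (Site 2)), E₀ ⊆ E ∧ (∀ e ∈ E, e ∈ (discreteDomainGraph D.carrier δ).edgeSet) ∧ (∀ x ∈ DiscreteRect.verts E, ∀ y ∈ DiscreteRect.verts E, (discreteDomainGraph D.carrier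 δ).Adj x y → s(x, y) ∈ E) ∧ (∀ x ∈ DiscreteRect.verts E, ∀ y ∈ DiscreteRect.verts E, Relation.ReflTransGen (fun a b : Site 2 => s(a, b) ∈ E) x y) ∧ (∀ g : Site 2, (∃ j : Fin 4, s(DiscreteRect.corner g j, DiscreteRect.corner g j + DiscreteRect.dir j) ∉ E) → ∀ M : ℤ, ∃ g' : Site 2, M ≤ g' 1 ∧ Relation.ReflTransGen (fun a b : Site 2 => ∃ j : Fin 4, b = a + DiscreteRect.dir (j + 3) ∧ s(DiscreteRect.corner a j, DiscreteRect.corner a j + DiscreteRect.dir j) ∉ E) g g') ∧ (∀ x ∈ DiscreteRect.bdVerts E, x ∈ DiscreteRect.verts E₀) ∧ (∀ x ∈ DiscreteRect.verts E, x ∈ DiscreteRect.verts E₀ ∨ ∃ h : Site 2, IsCorner x h ∧ ¬ ∀ M : ℤ, ∃ g' : Site 2, M ≤ g' 1 ∧ Relation.ReflTransGen (fun a b : Site 2 => ∃ k : Fin 4, b = a + cornerUnit k ∧ s(a + cornerOff (k + 1), a + cornerOff (k + 2)) ∉ E₀) h g') :=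
  fun D _ hδ _ hE₀ hind hconn => WindowRect.exists_filled_edgeSet D hδ hE₀ hind hconn

end Summit.CriticalPhenomena.SAWScalingLimit.Theorems.IsingBoundaryRatio

end
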